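import Summits.QuantumFields.YangMills.Theses.ScalingWindowSplit
import Literature.MathematicalPhysics.QuantumFieldTheory.LatticeGaugeProofs

/-!
# `GapAtCorrelationLength` (stmt-QuantumFields-18927) — negative lemma modulo `PersistentSlabCorrelation`

Negative lemma (refuter / standing disprover, cycle 1) for crux W₁ = `ScalingWindowSplit.GapAtCorrelationLength` of
route `ScalingWindowSplit`.  Tree objects only; the crux decl appears only negated.

**Finding (census §1 of `Cruxes/GapAtCorrelationLength/STRATEGY-CENSUS.md`, made a gate-level lemma here with the
WEAKEST hypothesis).**  The RP-spectral conjunct of W₁ quantifies over ALL bounded measurable functionals `Y` of a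
TIME slab — no spatial restriction, `Y` chosen after the torus size.  Hence W₁ is refuted by any admissible gauge
group carrying, at every large coupling and for every rate `μ > 0`, on arbitrarily large odd symmetric tori, a bounded
slab functional whose reflected time-`n` covariance stays `≥ e^{−μS}` across `n ≥ S/4`
(packaged over an admissible `G` as `PersistentSlabCorrelation`, the hypothesis `H`):
`GapAtCorrelationLength_false_of_PersistentSlabCorrelation : PersistentSlabCorrelation → ¬ GapAtCorrelationLength`.

**Why `H` is expected and why it is not constructible here.**  For the centre-free admissible group `G = SO(3)`
(`isCompactSimpleLieGroup_SO3`, landed) the disc-repaired `ℤ₂` magnetic-flux indicator through a spatial 2-torus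
(de Forcrand–Jahn, `η = ∏_{p ∈ plane} sign tr Ũ_p`, a proper `SO(3)` observable) is such a `Y` as soon as (1) the
minority flux sector keeps weight `≥ e^{−o(S)}` on symmetric tori at weak coupling ('t Hooft: flux is LIGHT in the
confined phase — even a Coulomb phase would do; it fails only in a magnetic-Meissner phase nobody proposes) and (2)
`ℤ₂`-monopole clusters are Peierls-dilute.  (2) is elementary but unformalised; (1) is rigorously open (variational /
Jensen bounds are extensive in the vortex sheet, reflection positivity bounds twisted partition functions only from
above).  `H` is implied by the strategist's `LightFlux` and by ideator 1's `LightFluxWeak` (proved in the disprover's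
work file `Cruxes/GapAtCorrelationLength/Disproof.lean` §2), so it is the weakest of the three.

**Class (on paper): refuted-MISSTATED modulo `H`.**  Repaired statement `C′`: replace the functional class
`DependsOn Y {e | 1 ≤ e.1 0 ∧ e.1 0 + [e.2 = 0] ≤ T₀}` of the RP-spectral conjunct by a LOCAL class — R1:
`DependsOn Y (slabBox T₀ R)` with `R < S₀` (spatial box of half-side `R`, typed as `Strategist.slabBox` in
`Cruxes/GapAtCorrelationLength/LightFluxObstruction.lean` Part B), or R2: finite sums of finite products of bounded
gauge-invariant functionals supported in slab ∩ (spatial cube of side `< 2S₀+1`) — every landed consumer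
(`stub_gapOfRPSpectral`, `stub_mirrorOfRPSpectral`, `existenceLeg`) instantiates `Y` in that class.  The flux witness
misses `C′` (a contractible support cannot see `H²(T³; π₁G)` flux).

Contents: `PersistentSlabCorrelation` (`H`, the only definition), `GapAtCorrelationLength_false_of_persistent_at`
(per-group form, hypothesis spelled out), `GapAtCorrelationLength_false_of_PersistentSlabCorrelation` (`H → ¬W₁`).  No `sorry`; axioms `propext`,
`Classical.choice`, `Quot.sound`.
-/

noncomputable section

open scoped BigOperators Topology
open MeasureTheory Filter Set Function
open Literature.MathematicalPhysics.QuantumLattice Literature.MathematicalPhysics.AQFT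
open Literature.MathematicalPhysics.QuantumFieldTheory

namespace Summit.QuantumFields.YangMills.Theorems.GapAtCorrelationLength.Negative

open Summit.QuantumFields.YangMills.Theses.ScalingWindowSplit (GapAtCorrelationLength)

/-- **`H` — `PersistentSlabCorrelation`** (hypothesis of the negative lemma; not a literature fact — it must stay in
this file).  Some ADMISSIBLE gauge group `G` (compact simple Lie, `IsCompactSimpleLieGroup G`) has SUBEXPONENTIALLY
PERSISTENT SLAB CORRELATION at weak coupling: for every faithful lattice representation `r` there is `β₀` such that at
every coupling `β ≥ β₀`, for every rate `μ > 0` and beyond every size `M₀`, some odd symmetric torus `(2S+1)⁴`, slab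
width `T`, separation `n` with `2(T+n+1) ≤ S ≤ 4n` and some measurable slab functional `Y`, `|Y| ≤ 1`, depending only
on the edges of the time slab `[1, T]`, satisfy `e^{−μS} ≤ ⟨ΘY · τ_nY⟩_{β,2S+1} − ⟨Y⟩²_{β,2S+1}` (integrals verbatim
as in W₁'s RP-spectral conjunct).  Expected inhabitant `G = SO(3)` (disc-repaired `ℤ₂` magnetic flux: subexponential
minority-sector weight + dilute monopoles); not constructible in the tree today (file docstring). -/
def PersistentSlabCorrelation : Prop :=
  ∃ (G : Type) (_ : Group G) (_ : TopologicalSpace G) (_ : IsTopologicalGroup G) (_ : CompactSpace G),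
    IsCompactSimpleLieGroup G ∧
    letI : MeasurableSpace G := borel G
    haveI : BorelSpace G := ⟨rfl⟩
    ∀ (r : LatticeRep G), ∃ β₀ : ℝ, ∀ β : ℝ, β₀ ≤ β → ∀ μ : ℝ, 0 < μ → ∀ M₀ : ℕ,
    ∃ (S T n : ℕ), M₀ ≤ S ∧ 2 * (T + n + 1) ≤ S ∧ S ≤ 4 * n ∧
    ∃ (Y : LGConfig 4 G → ℝ), Measurable Y ∧ (∀ U, |Y U| ≤ 1) ∧
      DependsOn Y {e : Literature.MathematicalPhysics.QuantumLattice.ZdEdge 4 |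
        1 ≤ e.1 0 ∧ e.1 0 + (if e.2 = 0 then 1 else 0) ≤ T} ∧
      Real.exp (-(μ * S)) ≤
        (∫ U, Y (torusLift (2 * S + 1) (GaugeConfig.timeReflect U)) *
            Y (configShift (-Pi.single 0 (n : ℤ)) (torusLift (2 * S + 1) U))
            ∂(wilsonMeasure r.ρ β : Measure (GaugeConfig 4 (2 * S + 1) G))) -
        (∫ U, Y (torusLift (2 * S + 1) U)
            ∂(wilsonMeasure r.ρ β : Measure (GaugeConfig 4 (2 * S + 1) G))) ^ 2

/-- **Per-group form: an admissible `G` with subexponentially persistent slab correlation refutes W₁.**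
Bookkeeping: W₁ at `G` gives `(r, sch, Δ, C)` with the RP-spectral conjunct eventually in `k`; pick `k` with the
conjunct active and `β_k ≥ β₀`; put `μ := Δ a_k / 8` and take the witness `(S, T, n, Y)` of `H` beyond `max N₀ L_k`;
the conjunct at `(S, T, n, Y, B = 1)` gives `e^{−μS} ≤ I_n − ⟨Y⟩² ≤ e^{−Δa_k n}(I_0 − ⟨Y⟩²) + C e^{−Δa_k S}
≤ e^{−2μS} + |C| e^{−8μS} < e^{−μS}` for `S ≥ N₀` (`I_0 ≤ 1` since `|Y| ≤ 1` and Wilson's measure is a probability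
measure, `isProbabilityMeasure_wilsonMeasure`). [folklore] -/
theorem GapAtCorrelationLength_false_of_persistent_at
    (G : Type) [Group G] [TopologicalSpace G] [IsTopologicalGroup G] [CompactSpace G]
    (hG : IsCompactSimpleLieGroup G)
    (hH : letI : MeasurableSpace G := borel G
      haveI : BorelSpace G := ⟨rfl⟩
      ∀ (r : LatticeRep G), ∃ β₀ : ℝ, ∀ β : ℝ, β₀ ≤ β → ∀ μ : ℝ, 0 < μ → ∀ M₀ : ℕ,
      ∃ (S T n : ℕ), M₀ ≤ S ∧ 2 * (T + n + 1) ≤ S ∧ S ≤ 4 * n ∧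
      ∃ (Y : LGConfig 4 G → ℝ), Measurable Y ∧ (∀ U, |Y U| ≤ 1) ∧
        DependsOn Y {e : Literature.MathematicalPhysics.QuantumLattice.ZdEdge 4 |
          1 ≤ e.1 0 ∧ e.1 0 + (if e.2 = 0 then 1 else 0) ≤ T} ∧
        Real.exp (-(μ * S)) ≤
          (∫ U, Y (torusLift (2 * S + 1) (GaugeConfig.timeReflect U)) *
              Y (configShift (-Pi.single 0 (n : ℤ)) (torusLift (2 * S + 1) U))
              ∂(wilsonMeasure r.ρ β : Measure (GaugeConfig 4 (2 * S + 1) G))) -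
          (∫ U, Y (torusLift (2 * S + 1) U)
              ∂(wilsonMeasure r.ρ β : Measure (GaugeConfig 4 (2 * S + 1) G))) ^ 2) :
    ¬ GapAtCorrelationLength := by
  intro hW
  letI : MeasurableSpace G := borel G
  haveI : BorelSpace G := ⟨rfl⟩
  obtain ⟨r, sch, u, p, M, Δ, C, hweak, -, hΔ, -, hRP, -, -⟩ := hW G hG
  obtain ⟨β₀, hβ₀⟩ := hH r
  obtain ⟨k, hRPk, hβk⟩ := (hRP.and (hweak.eventually_ge_atTop β₀)).exists
  have ha : 0 < sch.a k := sch.a_pos k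
  have hΔa : 0 < Δ * sch.a k := mul_pos hΔ ha
  set μ : ℝ := Δ * sch.a k / 8 with hμ_def
  have hμ : 0 < μ := by positivity
  -- h(S) := e^{-μS} + |C| e^{-7μS} → 0; beyond N₀ it is < 1
  set h : ℝ → ℝ := fun x => Real.exp (-(μ * x)) + |C| * Real.exp (-(7 * μ * x)) with hh_def
  have hh : Tendsto h atTop (𝓝 0) := by
    have t1 : Tendsto (fun x : ℝ => μ * x) atTop atTop := tendsto_id.const_mul_atTop hμ
    have t7 : Tendsto (fun x : ℝ => 7 * μ * x) atTop atTop :=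
      tendsto_id.const_mul_atTop (by positivity : (0:ℝ) < 7 * μ)
    have e1 : Tendsto (fun x : ℝ => Real.exp (-(μ * x))) atTop (𝓝 0) :=
      Real.tendsto_exp_atBot.comp (tendsto_neg_atTop_atBot.comp t1)
    have e2 : Tendsto (fun x : ℝ => |C| * Real.exp (-(7 * μ * x))) atTop (𝓝 (|C| * 0)) :=
      (Real.tendsto_exp_atBot.comp (tendsto_neg_atTop_atBot.comp t7)).const_mul |C|
    simpa [hh_def] using e1.add e2
  have hhN : Tendsto (fun S : ℕ => h S) atTop (𝓝 0) := hh.comp tendsto_natCast_atTop_atTop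
  obtain ⟨N₀, hN₀⟩ := eventually_atTop.1 (hhN.eventually (gt_mem_nhds (by norm_num : (0:ℝ) < 1)))
  obtain ⟨S, T, n, hMS, h2, h4, Y, hYm, hYb, hYdep, hlow⟩ := hβ₀ (sch.β k) hβk μ hμ (max N₀ (sch.L k))
  have hLS : sch.L k ≤ S := (le_max_right _ _).trans hMS
  have hNS : N₀ ≤ S := (le_max_left _ _).trans hMS
  have key := hRPk S T n hLS h2 Y 1 hYm hYb hYdep
  -- `I_0 ≤ 1` from `|Y| ≤ 1` on the probability space
  haveI := isProbabilityMeasure_wilsonMeasure (d := 4) (L := 2 * S + 1) r.ρ r.continuous (sch.β k)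
  have hI0 : (∫ U, Y (torusLift (2 * S + 1) (GaugeConfig.timeReflect U)) * Y (torusLift (2 * S + 1) U)
      ∂(wilsonMeasure r.ρ (sch.β k) : Measure (GaugeConfig 4 (2 * S + 1) G))) ≤ 1 := by
    have hb : ∀ U : GaugeConfig 4 (2 * S + 1) G,
        ‖Y (torusLift (2 * S + 1) (GaugeConfig.timeReflect U)) * Y (torusLift (2 * S + 1) U)‖ ≤ 1 := by
      intro U
      rw [Real.norm_eq_abs, abs_mul]
      have h₁ := hYb (torusLift (2 * S + 1) (GaugeConfig.timeReflect U))
      have h₂ := hYb (torusLift (2 * S + 1) U)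
      nlinarith [abs_nonneg (Y (torusLift (2 * S + 1) (GaugeConfig.timeReflect U))),
        abs_nonneg (Y (torusLift (2 * S + 1) U))]
    have := norm_integral_le_of_norm_le_const
      (μ := (wilsonMeasure r.ρ (sch.β k) : Measure (GaugeConfig 4 (2 * S + 1) G))) (Eventually.of_forall hb)
    rw [probReal_univ, mul_one, Real.norm_eq_abs] at this
    exact (le_abs_self _).trans this
  generalize hIn_def : (∫ U, Y (torusLift (2 * S + 1) (GaugeConfig.timeReflect U)) *
      Y (configShift (-Pi.single 0 (n : ℤ)) (torusLift (2 * S + 1) U))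
      ∂(wilsonMeasure r.ρ (sch.β k) : Measure (GaugeConfig 4 (2 * S + 1) G))) = In at key hlow
  generalize hI0_def : (∫ U, Y (torusLift (2 * S + 1) (GaugeConfig.timeReflect U)) *
      Y (torusLift (2 * S + 1) U)
      ∂(wilsonMeasure r.ρ (sch.β k) : Measure (GaugeConfig 4 (2 * S + 1) G))) = I0 at key hI0
  generalize hm_def : (∫ U, Y (torusLift (2 * S + 1) U)
      ∂(wilsonMeasure r.ρ (sch.β k) : Measure (GaugeConfig 4 (2 * S + 1) G))) = m at key hlow
  -- exponent algebra
  have hS4 : (S : ℝ) ≤ 4 * n := by exact_mod_cast h4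
  have hexp_n : Real.exp (-(Δ * sch.a k * n)) ≤ Real.exp (-(2 * μ * S)) := by
    apply Real.exp_le_exp.2
    rw [hμ_def]
    nlinarith [mul_le_mul_of_nonneg_left hS4 hΔa.le]
  have hsplit2 : Real.exp (-(2 * μ * S)) = Real.exp (-(μ * S)) * Real.exp (-(μ * S)) := by
    rw [← Real.exp_add]; ring_nf
  have hsplit8 : Real.exp (-(Δ * sch.a k * S)) = Real.exp (-(μ * S)) * Real.exp (-(7 * μ * S)) := by
    rw [← Real.exp_add, hμ_def]; ring_nf
  have hE : 0 < Real.exp (-(μ * S)) := Real.exp_pos _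
  have hexp0 : 0 ≤ Real.exp (-(Δ * sch.a k * n)) := Real.exp_nonneg _
  have hdiff : I0 - m ^ 2 ≤ 1 := by nlinarith [sq_nonneg m]
  have hup : In - m ^ 2 ≤ Real.exp (-(μ * S)) * h S := by
    have t1 : Real.exp (-(Δ * sch.a k * n)) * (I0 - m ^ 2) ≤ Real.exp (-(μ * S)) * Real.exp (-(μ * S)) := by
      calc Real.exp (-(Δ * sch.a k * n)) * (I0 - m ^ 2)
          ≤ Real.exp (-(Δ * sch.a k * n)) * 1 := mul_le_mul_of_nonneg_left hdiff hexp0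
        _ ≤ Real.exp (-(2 * μ * S)) := by simpa using hexp_n
        _ = _ := hsplit2
    have t2 : C * (1 : ℝ) ^ 2 * Real.exp (-(Δ * sch.a k * S)) ≤
        Real.exp (-(μ * S)) * (|C| * Real.exp (-(7 * μ * S))) := by
      rw [hsplit8]
      have hC := le_abs_self C
      have hE7 : 0 ≤ Real.exp (-(7 * μ * S)) := Real.exp_nonneg _
      nlinarith [mul_nonneg hE.le hE7]
    have hlhs : In - m ^ 2 ≤ |In - m ^ 2| := le_abs_self _
    have : In - m ^ 2 ≤ Real.exp (-(μ * S)) * Real.exp (-(μ * S)) +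
        Real.exp (-(μ * S)) * (|C| * Real.exp (-(7 * μ * S))) := by linarith
    simpa [hh_def, mul_add] using this
  have hhS : h S < 1 := hN₀ S hNS
  have : Real.exp (-(μ * S)) * h S < Real.exp (-(μ * S)) * 1 := mul_lt_mul_of_pos_left hhS hE
  linarith

/-- **Negative lemma modulo `H`: `PersistentSlabCorrelation → ¬ GapAtCorrelationLength`.**  Class (on paper):
refuted-misstated — `C′` re-quantifies the RP-spectral conjunct over LOCAL slab functionals (R1 `slabBox` / R2 local
gauge-invariant algebra); the global flux witness behind `H` does not meet `C′`'s functional class. [folklore] -/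
theorem GapAtCorrelationLength_false_of_PersistentSlabCorrelation :
    PersistentSlabCorrelation → ¬ GapAtCorrelationLength := by
  rintro ⟨G, _, _, _, _, hG, hH⟩
  exact GapAtCorrelationLength_false_of_persistent_at G hG hH

end Summit.QuantumFields.YangMills.Theorems.GapAtCorrelationLength.Negative

end
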